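import Literature.NumberTheory.EllipticCurves.PAdicOneVariableNormCoherentUnitFamilyTwo
import Literature.NumberTheory.EllipticCurves.PAdicOneVariableNormCoherentUnitMomentsTwo
import Literature.NumberTheory.EllipticCurves.ProfiniteGroupDistributionDivisionCocycle
import HarnessLib

/-!
# `p = 2`: the MOMENTS of de Shalit's `i(b) = induce D b` for a norm-coherent unit —
# `∫_{Γ_F} κ^{k+1} d i(b) = [S^0] D^k (θ((δb)~ ∘ ϑ))` (I.3.5 (11) / II.4.7 (17) for the local tower)

Topic `NumberTheory/EllipticCurves`; namespace `Literature.NumberTheory.EllipticCurves`.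

De Shalit, *Iwasawa theory of elliptic curves with complex multiplication* (1987), I.3.5 (11):
"`∫_G κ^k dμ_β = D^k log g_β (0) = δ_k(β)`" and II.4.7 (16)–(17): the integrals of `i(β) = μ_β` are the
numbers `δ_k(σβ)` read coset by coset.  `PAdicOneVariableNormCoherentUnitFamilyTwo.lean` packaged
`i := GroupDistribution.induce D` for the family `D b = comap ((x⁻¹ D_{H_b})|_{ℤ₂^×}) ψ` of a `Γ_F`-monoid `B`
mapped to the norm-coherent units of the Lubin–Tate tower of `f' = π'X + X²` (`H_b = Θ((δ(η b))~ ∘ ϑ)`,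
`Θ : 𝐃 → 𝕜`), and `PAdicOneVariableNormCoherentUnitMomentsTwo.lean` computed the moments of `D_β` for
`𝕜 = ℂ_[2]` with the series read through `𝒪_{ℂ_F}` and `θ : ℂ_F → ℂ_[2]`.  This file joins the two at
`Θ := θ ∘ (𝒪_{ℂ_F} ⊆ ℂ_F) ∘ (𝐃 → 𝒪_{ℂ_F})`:

* §1 (generic) `density` / `restrictUnits` / `comap` / `invAmice₁` depend only on the LEVEL DATA of their input
  (`…_μ_congr_of_μ_eq`, `invAmice₁_μ_congr` — any two bound proofs);
* §2 `map_subst_compSeriesC_comp_eq` — the `Θ`-currency series IS the `θ`-currency series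
  (`subst_map_compSeriesC_eq_map` of `PAdicOneVariableSocketUnramifiedReading.lean` + `map_map`), hence
  `comap_μ_normCoherentUnits_comp_eq` (the two pulled-back measures agree levelwise);
* §3 ★★ `integral_induce_indicator_ltCharacter_pow_succ_normCoherentUnits` —
  **`∫_{Γ_F} 𝟙_{U_0} κ^{k+1} d i(b) = [S^0] D^k H_{η b}`**, and, since `U_0 = Γ_F` at `q = 2`
  (`mem_ltTower_U_zero`), ★★ `integral_induce_ltCharacter_pow_succ_normCoherentUnits` —
  **`∫_{Γ_F} κ^{k+1} d i(b) = [S^0] D^k H_{η b}`** (de Shalit's `δ̃_{k+1}(η b)`), with the right-hand side also in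
  `𝐃`-currency (`…_eq_theta_toC`: `= θ(ι([S^0] D^k ((δ(η b))~ ∘ ϑ)))`).

Everything is proved; no named facts, no definitions, no instances (section-local instance attributes as
in the siblings), no `sorry`.

## References

* [deShalit1987] E. de Shalit, *Iwasawa theory of elliptic curves with complex multiplication* (1987),
  I.3.4 (10), I.3.5 (11) (p. 18), II.4.6 (14), II.4.7 (16)–(17) (p. 59–60).
-/

noncomputable section

open MvPowerSeries Filter
open scoped Topology Classical

namespace Literature.NumberTheory.EllipticCurves

/-! ### §1. Generic: the constructions depend only on the level data -/

namespace BoundedDistribution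

variable {X : Type*} [PseudoMetricSpace X] {T : ProfiniteTower X}
variable {𝕜 : Type*} [NormedField 𝕜] [IsUltrametricDist 𝕜] [CompleteSpace 𝕜]

/-- `g · D` depends only on the level data of `D`. [cite: deShalit1987, I.3.5 (11) (p. 18)] -/
theorem density_μ_congr_of_μ_eq (D D' : BoundedDistribution T 𝕜) (h : ∀ n a, D.μ n a = D'.μ n a)
    (hT : T.IsUniform) (g : X → 𝕜) (hg : UniformContinuous g) (hg1 : ∀ x, ‖g x‖ ≤ 1) (n : ℕ) (a : T.Cell n) :
    (D.density hT g hg hg1).μ n a = (D'.density hT g hg hg1).μ n a := by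
  rw [density_μ, density_μ]
  exact integral_congr_of_μ_eq D D' h _

end BoundedDistribution

section Congr

variable {p : ℕ} [Fact p.Prime] {𝕜 : Type*} [NormedField 𝕜]

/-- `(·)|_{ℤ_p^×}` depends only on the level data. [cite: deShalit1987, I.3.3 (7′) (p. 17–18)] -/
theorem restrictUnits_μ_congr_of_μ_eq (ν ν' : BoundedDistribution (ProfiniteTower.padicInt p) 𝕜)
    (h : ∀ n a, ν.μ n a = ν'.μ n a) (n : ℕ) (b : ZMod (p ^ (n + 1))) :
    (restrictUnits ν).μ n b = (restrictUnits ν').μ n b := by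
  rw [restrictUnits_μ, restrictUnits_μ, h]

variable [NormedAlgebra ℚ_[p] 𝕜] [IsUltrametricDist 𝕜] [CompleteSpace 𝕜]

/-- `D_P` depends only on the series `P` (not on the bound or its proof). [cite: deShalit1987, I.3.3 (8) (p. 17)] -/
theorem invAmice₁_μ_congr {P P' : PowerSeries 𝕜} {C C' : ℝ} (hPP' : P = P')
    (hC : ∀ k, ‖PowerSeries.coeff k P‖ ≤ C) (hC' : ∀ k, ‖PowerSeries.coeff k P'‖ ≤ C') (n : ℕ)
    (a : ZMod (p ^ n)) : (invAmice₁ p P hC).μ n a = (invAmice₁ p P' hC').μ n a := by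
  subst hPP'
  rfl

end Congr

namespace GroupDistribution

variable {G : Type*} [Group G] {𝒰 : SubgroupTower G} [∀ n, (𝒰.U n).Normal] {X : Type*}
  [PseudoMetricSpace X] {T : ProfiniteTower X} {𝕜 : Type*} [NormedField 𝕜]

/-- The pull-back `comap` depends only on the level data. [cite: deShalit1987, I.3.3 (9) (p. 18)] -/
theorem comap_μ_congr_of_μ_eq (ν ν' : BoundedDistribution T 𝕜)
    (ψ : (n : ℕ) → G ⧸ 𝒰.U n → T.Cell n) (hψ) (hinj) (hsurj) (h : ∀ n a, ν.μ n a = ν'.μ n a) (n : ℕ)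
    (a : G ⧸ 𝒰.U n) : (comap ν ψ hψ hinj hsurj).μ n a = (comap ν' ψ hψ hinj hsurj).μ n a := by
  rw [comap_μ, comap_μ, h]

end GroupDistribution

/-! ### §2. `Θ = θ ∘ (𝒪_{ℂ_F} ⊆ ℂ_F) ∘ (𝐃 → 𝒪_{ℂ_F})`: the two currencies give the same series and measure -/

section InduceMomentsTwo

open ValuativeRel IsLocalRing Field
open Literature.NumberTheory.GaloisRepresentations Literature.NumberTheory.GaloisRepresentations.IsNonarchimedeanLocalField
  Literature.NumberTheory.GaloisRepresentations.LubinTate Literature.NumberTheory.PAdicHodge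

variable {F : Type} [Field F] [ValuativeRel F] [TopologicalSpace F] [IsNonarchimedeanLocalField F]

attribute [local instance] ltNormUniformSpace ltNormIsUniformAddGroup rk1 nF nE fintypeResidueField
attribute [local instance] ltTower_U_normal

variable (hq : residueFieldCard F = 2) (h2 : (valuation F).IsUniformizer (((2 : ℕ) : 𝒪[F]) : F))
  {σ₀ : absoluteGaloisGroup F} (hσ₀ : IsAbsArithFrob σ₀) (u : 𝒪[F]ˣ)
  {ε : (maxUnramifiedCompletion F)ˣ}
  (hε : maxUnramifiedCompletion.galAut F σ₀ (ε : maxUnramifiedCompletion F) =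
    algebraMap 𝒪[F] (maxUnramifiedCompletion F) (u : 𝒪[F]) * (ε : maxUnramifiedCompletion F))
variable (θ : CompletedAlgClosure F →+* ℂ_[2]) (hθc : Continuous θ)
  (hθ1 : ∀ z : CBall F, ‖θ (z : CompletedAlgClosure F)‖ ≤ 1)
  (hθζ : ∀ ζ' : ℂ_[2], (∃ n : ℕ, ζ' ^ 2 ^ n = 1) →
    ∃ ζ : CompletedAlgClosure F, (∃ n : ℕ, ζ ^ 2 ^ n = 1) ∧ θ ζ = ζ')

/-- **The `Θ`-currency series is the `θ`-currency series**: composing with `ϑ` over `𝐃` and mapping by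
`Θ = θ ∘ (𝒪_{ℂ_F} ⊆ ℂ_F) ∘ (𝐃 → 𝒪_{ℂ_F})` equals composing over `𝒪_{ℂ_F}` and mapping by `θ ∘ (𝒪_{ℂ_F} ⊆ ℂ_F)`.
[cite: deShalit1987, I.3.3 (8) (p. 17)] -/
theorem map_subst_compSeriesC_comp_eq (h₀ : PowerSeries (LTCoeff F)) :
    ((PowerSeries.subst (compSeriesC h2 hσ₀ u hε)
        (h₀.map ((intToUnrCoeff F).comp (LTCoeff.of F).symm.toRingHom))).map
        (θ.comp ((CBall F).subtype.comp (algebraMap (UnrCoeff F) (CBall F))))) =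
      ((PowerSeries.subst ((compSeriesC h2 hσ₀ u hε).map (algebraMap (UnrCoeff F) (CBall F)))
        (h₀.map ((algebraMap (UnrCoeff F) (CBall F)).comp
          ((intToUnrCoeff F).comp (LTCoeff.of F).symm.toRingHom)))).map (θ.comp (CBall F).subtype)) := by
  rw [subst_map_compSeriesC_eq_map]
  exact (MvPowerSeries.map_map _ _ _).symm

variable (e : 𝒪[F] ≃+* ℤ_[2])
  (ψ : (n : ℕ) → absoluteGaloisGroup F ⧸ (ltTower (isUniformizer_unit_mul h2 u)).U n → ZMod (2 ^ (n + 1)))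
  (hψ : ∀ (n : ℕ) (σ : absoluteGaloisGroup F), σ ∈ (ltTower (isUniformizer_unit_mul h2 u)).U 0 →
    ψ n ((ltTower (isUniformizer_unit_mul h2 u)).proj n σ) = PadicInt.toZModPow (n + 1)
      (((Units.map (e : 𝒪[F] →+* ℤ_[2]).toMonoidHom).comp (lubinTateCharHom (isUniformizer_unit_mul h2 u)) σ :
        ℤ_[2]ˣ) : ℤ_[2]))

/-- The pulled-back measures in the two currencies agree levelwise (for ANY bound proof in the
`Θ`-currency). [cite: deShalit1987, I.3.3 (8)–(9) (p. 17–18)] -/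
theorem comap_μ_normCoherentUnits_comp_eq (β : NormCoherentUnits (isUniformizer_unit_mul h2 u)) {C : ℝ}
    (hC : ∀ k : ℕ, ‖PowerSeries.coeff k ((PowerSeries.subst (compSeriesC h2 hσ₀ u hε)
          ((tildeSer ((u : 𝒪[F]) * ((2 : ℕ) : 𝒪[F])) (LTCoeff.of F (u : 𝒪[F])) β.logDeriv).map
            ((intToUnrCoeff F).comp (LTCoeff.of F).symm.toRingHom))).map (θ.comp ((CBall F).subtype.comp (algebraMap (UnrCoeff F) (CBall F)))))‖ ≤ C) (n : ℕ)
    (a : absoluteGaloisGroup F ⧸ (ltTower (isUniformizer_unit_mul h2 u)).U n) :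
    (GroupDistribution.comap (restrictUnits ((invAmice₁ 2 ((PowerSeries.subst (compSeriesC h2 hσ₀ u hε)
          ((tildeSer ((u : 𝒪[F]) * ((2 : ℕ) : 𝒪[F])) (LTCoeff.of F (u : 𝒪[F])) β.logDeriv).map
            ((intToUnrCoeff F).comp (LTCoeff.of F).symm.toRingHom))).map (θ.comp ((CBall F).subtype.comp (algebraMap (UnrCoeff F) (CBall F))))) hC).density
          (ProfiniteTower.padicInt_isUniform 2) (unitInv ℂ_[2]) uniformContinuous_unitInv norm_unitInv_le))
          ψ ((ltTower (isUniformizer_unit_mul h2 u)).cellMap_trans _ ψ hψ)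
          ((ltTower (isUniformizer_unit_mul h2 u)).cellMap_injective _
            (mem_ltTower_iff (isUniformizer_unit_mul h2 u) e) ψ hψ)
          ((ltTower (isUniformizer_unit_mul h2 u)).cellMap_fiberSurj _
            (mem_ltTower_iff (isUniformizer_unit_mul h2 u) e)
            (exists_toZModPow_ltCharacter_eq (isUniformizer_unit_mul h2 u) e) ψ hψ)).μ n a =
      (GroupDistribution.comap (restrictUnits ((invAmice₁ 2 ((PowerSeries.subst ((compSeriesC h2 hσ₀ u hε).map (algebraMap (UnrCoeff F) (CBall F)))
          ((tildeSer ((u : 𝒪[F]) * ((2 : ℕ) : 𝒪[F])) (LTCoeff.of F (u : 𝒪[F])) β.logDeriv).map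
            ((algebraMap (UnrCoeff F) (CBall F)).comp
              ((intToUnrCoeff F).comp (LTCoeff.of F).symm.toRingHom)))).map (θ.comp (CBall F).subtype)) (norm_coeff_map_le_one θ hθ1
          (PowerSeries.subst ((compSeriesC h2 hσ₀ u hε).map (algebraMap (UnrCoeff F) (CBall F)))
            ((tildeSer ((u : 𝒪[F]) * ((2 : ℕ) : 𝒪[F])) (LTCoeff.of F (u : 𝒪[F])) β.logDeriv).map
              ((algebraMap (UnrCoeff F) (CBall F)).comp
                ((intToUnrCoeff F).comp (LTCoeff.of F).symm.toRingHom)))))).density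
          (ProfiniteTower.padicInt_isUniform 2) (unitInv ℂ_[2]) uniformContinuous_unitInv norm_unitInv_le))
          ψ ((ltTower (isUniformizer_unit_mul h2 u)).cellMap_trans _ ψ hψ)
          ((ltTower (isUniformizer_unit_mul h2 u)).cellMap_injective _
            (mem_ltTower_iff (isUniformizer_unit_mul h2 u) e) ψ hψ)
          ((ltTower (isUniformizer_unit_mul h2 u)).cellMap_fiberSurj _
            (mem_ltTower_iff (isUniformizer_unit_mul h2 u) e)
            (exists_toZModPow_ltCharacter_eq (isUniformizer_unit_mul h2 u) e) ψ hψ)).μ n a := by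
  have h₁ := invAmice₁_μ_congr (p := 2) (map_subst_compSeriesC_comp_eq h2 hσ₀ u hε θ _) hC (norm_coeff_map_le_one θ hθ1
          (PowerSeries.subst ((compSeriesC h2 hσ₀ u hε).map (algebraMap (UnrCoeff F) (CBall F)))
            ((tildeSer ((u : 𝒪[F]) * ((2 : ℕ) : 𝒪[F])) (LTCoeff.of F (u : 𝒪[F])) β.logDeriv).map
              ((algebraMap (UnrCoeff F) (CBall F)).comp
                ((intToUnrCoeff F).comp (LTCoeff.of F).symm.toRingHom)))))
  have h₂ := BoundedDistribution.density_μ_congr_of_μ_eq _ _ h₁ (ProfiniteTower.padicInt_isUniform 2)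
    (unitInv ℂ_[2]) uniformContinuous_unitInv norm_unitInv_le
  have h₃ := restrictUnits_μ_congr_of_μ_eq _ _ h₂
  exact GroupDistribution.comap_μ_congr_of_μ_eq (T := (ProfiniteTower.padicInt 2).succ) _ _ ψ _ _ _ h₃ n a

/-! ### §3. The moments of `i(b)` -/

variable (hΘe : ∀ a : 𝒪[F], (θ.comp ((CBall F).subtype.comp (algebraMap (UnrCoeff F) (CBall F)))) (intToUnrCoeff F a) =
    padicIntCast ℂ_[2] ((e : 𝒪[F] →+* ℤ_[2]) a))
variable {B : Type*} [Monoid B] [MulDistribMulAction (absoluteGaloisGroup F) B]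
  (η : B → NormCoherentUnits (isUniformizer_unit_mul h2 u))
  (hη : ∀ (σ : absoluteGaloisGroup F) (b : B), η (σ • b) = (η b).galAct σ)
  {C : ℝ}
  (hC : ∀ (b : B) (k : ℕ), ‖PowerSeries.coeff k ((PowerSeries.subst (compSeriesC h2 hσ₀ u hε)
          ((tildeSer ((u : 𝒪[F]) * ((2 : ℕ) : 𝒪[F])) (LTCoeff.of F (u : 𝒪[F])) (η b).logDeriv).map
            ((intToUnrCoeff F).comp (LTCoeff.of F).symm.toRingHom))).map (θ.comp ((CBall F).subtype.comp (algebraMap (UnrCoeff F) (CBall F)))))‖ ≤ C)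
  (hC0 : 0 ≤ C)
  (hCb : ∀ b : B, (GroupDistribution.comap (restrictUnits ((invAmice₁ 2 ((PowerSeries.subst (compSeriesC h2 hσ₀ u hε)
          ((tildeSer ((u : 𝒪[F]) * ((2 : ℕ) : 𝒪[F])) (LTCoeff.of F (u : 𝒪[F])) (η b).logDeriv).map
            ((intToUnrCoeff F).comp (LTCoeff.of F).symm.toRingHom))).map (θ.comp ((CBall F).subtype.comp (algebraMap (UnrCoeff F) (CBall F))))) (hC b)).density
          (ProfiniteTower.padicInt_isUniform 2) (unitInv ℂ_[2]) uniformContinuous_unitInv norm_unitInv_le))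
          ψ ((ltTower (isUniformizer_unit_mul h2 u)).cellMap_trans _ ψ hψ)
          ((ltTower (isUniformizer_unit_mul h2 u)).cellMap_injective _
            (mem_ltTower_iff (isUniformizer_unit_mul h2 u) e) ψ hψ)
          ((ltTower (isUniformizer_unit_mul h2 u)).cellMap_fiberSurj _
            (mem_ltTower_iff (isUniformizer_unit_mul h2 u) e)
            (exists_toZModPow_ltCharacter_eq (isUniformizer_unit_mul h2 u) e) ψ hψ)).bound ≤ C)

include hq hθc hθ1 hθζ hΘe hη in
/-- ★★ **The moments of `i(b)` on the top level**: `∫_{Γ_F} 𝟙_{U_0}(σ) κ(σ)^{k+1} d i(b)(σ) = [S^0] D^k H_{η b}`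
(de Shalit's (10)+(11): `i(b)` reads `D_{η b}` on `U_0`, whose moments are those of `ν_{η b}` on `ℤ₂^×`).
[cite: deShalit1987, I.3.4 (10), I.3.5 (11) (p. 18), II.4.7 (16)–(17) (p. 60)] -/
theorem integral_induce_indicator_ltCharacter_pow_succ_normCoherentUnits (n : ℕ) (b : B) (k : ℕ) :
    (GroupDistribution.induce (fun b ↦ (GroupDistribution.comap (restrictUnits ((invAmice₁ 2 ((PowerSeries.subst (compSeriesC h2 hσ₀ u hε)
          ((tildeSer ((u : 𝒪[F]) * ((2 : ℕ) : 𝒪[F])) (LTCoeff.of F (u : 𝒪[F])) (η b).logDeriv).map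
            ((intToUnrCoeff F).comp (LTCoeff.of F).symm.toRingHom))).map (θ.comp ((CBall F).subtype.comp (algebraMap (UnrCoeff F) (CBall F))))) (hC b)).density
          (ProfiniteTower.padicInt_isUniform 2) (unitInv ℂ_[2]) uniformContinuous_unitInv norm_unitInv_le))
          ψ ((ltTower (isUniformizer_unit_mul h2 u)).cellMap_trans _ ψ hψ)
          ((ltTower (isUniformizer_unit_mul h2 u)).cellMap_injective _
            (mem_ltTower_iff (isUniformizer_unit_mul h2 u) e) ψ hψ)
          ((ltTower (isUniformizer_unit_mul h2 u)).cellMap_fiberSurj _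
            (mem_ltTower_iff (isUniformizer_unit_mul h2 u) e)
            (exists_toZModPow_ltCharacter_eq (isUniformizer_unit_mul h2 u) e) ψ hψ))) hC0 hCb b).integral
        (fun σ ↦ (if (ltTower (isUniformizer_unit_mul h2 u)).proj 0 σ = 1 then (1 : ℂ_[2]) else 0) *
          padicIntCast ℂ_[2] ((((Units.map (e : 𝒪[F] →+* ℤ_[2]).toMonoidHom).comp (lubinTateCharHom (isUniformizer_unit_mul h2 u)) σ : ℤ_[2]ˣ) : ℤ_[2]) ^ (k + 1))) =
      PowerSeries.constantCoeff (mahlerD^[k] ((PowerSeries.subst ((compSeriesC h2 hσ₀ u hε).map (algebraMap (UnrCoeff F) (CBall F)))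
          ((tildeSer ((u : 𝒪[F]) * ((2 : ℕ) : 𝒪[F])) (LTCoeff.of F (u : 𝒪[F])) (η b).logDeriv).map
            ((algebraMap (UnrCoeff F) (CBall F)).comp
              ((intToUnrCoeff F).comp (LTCoeff.of F).symm.toRingHom)))).map (θ.comp (CBall F).subtype))) := by
  rw [← integral_comap_ltCharacter_pow_succ_normCoherentUnits hq h2 hσ₀ u hε θ hθc hθ1 hθζ e ψ hψ n (η b) k]
  refine GroupDistribution.integral_congr_of_μ_eq _ _ (fun m a ↦ ?_) _
  rw [induce_μ_eq_normCoherentUnits hq h2 hσ₀ u hε (θ.comp ((CBall F).subtype.comp (algebraMap (UnrCoeff F) (CBall F)))) e ψ hψ hΘe η hη hC hC0 hCb b m a]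
  exact comap_μ_normCoherentUnits_comp_eq h2 hσ₀ u hε θ hθ1 e ψ hψ (η b) (hC b) m a

include hq hθc hθ1 hθζ hΘe hη in
/-- ★★ **The moments of `i(b)`** at residue field `𝔽₂` (`U_0 = Γ_F`, so no indicator is needed):
`∫_{Γ_F} κ(σ)^{k+1} d i(b)(σ) = [S^0] D^k H_{η b} = δ̃_{k+1}(η b)`.
[cite: deShalit1987, I.3.5 (11) (p. 18), II.4.7 (17) (p. 60)] -/
theorem integral_induce_ltCharacter_pow_succ_normCoherentUnits (n : ℕ) (b : B) (k : ℕ) :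
    (GroupDistribution.induce (fun b ↦ (GroupDistribution.comap (restrictUnits ((invAmice₁ 2 ((PowerSeries.subst (compSeriesC h2 hσ₀ u hε)
          ((tildeSer ((u : 𝒪[F]) * ((2 : ℕ) : 𝒪[F])) (LTCoeff.of F (u : 𝒪[F])) (η b).logDeriv).map
            ((intToUnrCoeff F).comp (LTCoeff.of F).symm.toRingHom))).map (θ.comp ((CBall F).subtype.comp (algebraMap (UnrCoeff F) (CBall F))))) (hC b)).density
          (ProfiniteTower.padicInt_isUniform 2) (unitInv ℂ_[2]) uniformContinuous_unitInv norm_unitInv_le))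
          ψ ((ltTower (isUniformizer_unit_mul h2 u)).cellMap_trans _ ψ hψ)
          ((ltTower (isUniformizer_unit_mul h2 u)).cellMap_injective _
            (mem_ltTower_iff (isUniformizer_unit_mul h2 u) e) ψ hψ)
          ((ltTower (isUniformizer_unit_mul h2 u)).cellMap_fiberSurj _
            (mem_ltTower_iff (isUniformizer_unit_mul h2 u) e)
            (exists_toZModPow_ltCharacter_eq (isUniformizer_unit_mul h2 u) e) ψ hψ))) hC0 hCb b).integral
        (fun σ ↦ padicIntCast ℂ_[2] ((((Units.map (e : 𝒪[F] →+* ℤ_[2]).toMonoidHom).comp (lubinTateCharHom (isUniformizer_unit_mul h2 u)) σ : ℤ_[2]ˣ) : ℤ_[2]) ^ (k + 1))) =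
      PowerSeries.constantCoeff (mahlerD^[k] ((PowerSeries.subst ((compSeriesC h2 hσ₀ u hε).map (algebraMap (UnrCoeff F) (CBall F)))
          ((tildeSer ((u : 𝒪[F]) * ((2 : ℕ) : 𝒪[F])) (LTCoeff.of F (u : 𝒪[F])) (η b).logDeriv).map
            ((algebraMap (UnrCoeff F) (CBall F)).comp
              ((intToUnrCoeff F).comp (LTCoeff.of F).symm.toRingHom)))).map (θ.comp (CBall F).subtype))) := by
  rw [← integral_induce_indicator_ltCharacter_pow_succ_normCoherentUnits hq h2 hσ₀ u hε θ hθc hθ1 hθζ e ψ hψ hΘe η hη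
    hC hC0 hCb n b k]
  refine GroupDistribution.integral_congr _ (fun σ ↦ ?_)
  rw [SubgroupTower.proj_apply, (QuotientGroup.eq_one_iff σ).mpr (mem_ltTower_U_zero h2 u e σ), if_pos rfl, one_mul]

include hq hθc hθ1 hθζ hΘe hη in
/-- The same with the right-hand side in `𝐃`-currency: `∫_{Γ_F} κ^{k+1} d i(b) = θ(ι([S^0] D^k ((δ(η b))~ ∘ ϑ)))`,
`ι = maxUnramifiedCompletion.toC F` — de Shalit's `δ̃_{k+1}(η b) ∈ 𝐃` read in `ℂ_2`.
[cite: deShalit1987, I.3.4 (p. 18), I.3.5 (11) (p. 18)] -/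
theorem integral_induce_ltCharacter_pow_succ_normCoherentUnits_eq_theta_toC (n : ℕ) (b : B) (k : ℕ) :
    (GroupDistribution.induce (fun b ↦ (GroupDistribution.comap (restrictUnits ((invAmice₁ 2 ((PowerSeries.subst (compSeriesC h2 hσ₀ u hε)
          ((tildeSer ((u : 𝒪[F]) * ((2 : ℕ) : 𝒪[F])) (LTCoeff.of F (u : 𝒪[F])) (η b).logDeriv).map
            ((intToUnrCoeff F).comp (LTCoeff.of F).symm.toRingHom))).map (θ.comp ((CBall F).subtype.comp (algebraMap (UnrCoeff F) (CBall F))))) (hC b)).density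
          (ProfiniteTower.padicInt_isUniform 2) (unitInv ℂ_[2]) uniformContinuous_unitInv norm_unitInv_le))
          ψ ((ltTower (isUniformizer_unit_mul h2 u)).cellMap_trans _ ψ hψ)
          ((ltTower (isUniformizer_unit_mul h2 u)).cellMap_injective _
            (mem_ltTower_iff (isUniformizer_unit_mul h2 u) e) ψ hψ)
          ((ltTower (isUniformizer_unit_mul h2 u)).cellMap_fiberSurj _
            (mem_ltTower_iff (isUniformizer_unit_mul h2 u) e)
            (exists_toZModPow_ltCharacter_eq (isUniformizer_unit_mul h2 u) e) ψ hψ))) hC0 hCb b).integral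
        (fun σ ↦ padicIntCast ℂ_[2] ((((Units.map (e : 𝒪[F] →+* ℤ_[2]).toMonoidHom).comp (lubinTateCharHom (isUniformizer_unit_mul h2 u)) σ : ℤ_[2]ˣ) : ℤ_[2]) ^ (k + 1))) =
      θ (maxUnramifiedCompletion.toC F ((UnrCoeff.of F).symm
        (PowerSeries.constantCoeff (mahlerD^[k]
          (((tildeSer ((u : 𝒪[F]) * ((2 : ℕ) : 𝒪[F])) (LTCoeff.of F (u : 𝒪[F])) (η b).logDeriv).map
            ((intToUnrCoeff F).comp (LTCoeff.of F).symm.toRingHom)).subst (compSeriesC h2 hσ₀ u hε)))))) := by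
  rw [integral_induce_ltCharacter_pow_succ_normCoherentUnits hq h2 hσ₀ u hε θ hθc hθ1 hθζ e ψ hψ hΘe η hη hC hC0 hCb n b k,
    constantCoeff_mahlerD_iterate_map_theta]

end InduceMomentsTwo

end Literature.NumberTheory.EllipticCurves

end
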